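/-
Copyright (c) 2026 the pub-hodgecm-mathlib formalisation cell (harness21).  Prover seat hodgecm-mathlib-K2Liu-p08 (g2), Track B «K2-LIT»,
#184♮ = hLiu418 = `stmt-HodgeConjecture-24832`; LEAD F0P6-plan (g12) RULING «M-156n» (3) 2026-09-04T08:09:40Z + «=» 08:12:06Z, K2E5-plan (g6) «=» 08:12:41Z;
census `K2/K2Liu-p08/g2/CENSUS-G7G8-HeightVsIwasawa.K2Liu-p08-g2.md`.  The general-block-size lattice half of G7-C, split off `K2LiuIwasawaHeightLatticeSumBound` for size.
-/
import Summits.HodgeConjecture.HodgeConjecture.Theorems.K2LiuArchBlockHeightBound            -- ★ G7-B: `norm_apply_le_re_trace_of_posDef`, `re_trace_eq_sum` (+ ★ G7-A)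
import HarnessLib

/-!
# Crux `HLiu418`, Road Φ, gap G7-C (lattice half): SUMS OVER THE POSITIVE-DEFINITE PART OF A LATTICE IN `S → M_p(ℂ)`, TRACE-SPELLED, ANY BLOCK SIZE

Cell `hodgecm-mathlib`, crux item hLiu418 = `stmt-HodgeConjecture-24832`; LEAD F0P6-plan (g12) (M-156n (3)), co-dealer K2E5-plan (g6).  THEOREMS ONLY (no `def`,
no instance, no notation, no named-fact hypothesis, no `sorry`); lane `--supports stmt-HodgeConjecture-24832 --as helper` (count-neutral).  PURE MATHLIB over ★ G7-A∕G7-B.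
Consumer: `K2LiuIwasawaHeightLatticeSumBound.latticeSum_le_height` (the face Φ9-CORE consumes).

THE MATHEMATICS: the general-size twin of ★ G7-A `exists_tsum_lattice_posDef_prod_le` (which is spelled for `Fin 2` through the entries): for a full discrete
`ℤ`-lattice `Λ ⊂ S → (p → p → ℂ)` (Pi sup norm) and a real exponent `N ≥ 0` there are `C ≥ 0`, `k` with, for every `0 < ε ≤ 1` and every `g : S → M_p(ℂ)`,
`g_σ − ε•1 ⪰ 0`:  `Σ'_{x ∈ Λ, x_σ ≻ 0 ∀σ} ∏_σ e^{−2π Re tr(x_σ g_σ)} (1 + Re tr x_σ)^N ≤ C / ε^k` (and summable) — entries of `x_σ ≻ 0` are `≤ Re tr x_σ`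
(★ G7-B `norm_apply_le_re_trace_of_posDef`), the cone step `ε Re tr x_σ ≤ Re tr(x_σ g_σ)` (★ G7-A `mul_re_trace_le_re_trace_mul`), and ★ G7-A
`exists_tsum_pow_mul_exp_neg_le`.
* `norm_apply_le_pi_norm`, `pi_norm_le_sum` (sup-norm bookkeeping), `prod_trace_summand_le` (the pointwise comparison), **`exists_tsum_lattice_posDef_trace_le`**.
[Shimura1997, §A3] [MoeglinWaldspurger1995, II.1.5].
HONEST LABEL.  Count-neutral helper; `HC_CM` is proved only modulo the 7 printed citations (2 remaining named inputs: hLiu418 = `stmt-HodgeConjecture-24832`,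
h413 = `stmt-HodgeConjecture-24833`) until rung 0 closes.
-/

set_option autoImplicit false
set_option linter.dupNamespace false -- the mandated namespace repeats `HodgeConjecture.HodgeConjecture`

noncomputable section

open scoped BigOperators ComplexOrder Matrix
open Finset

namespace Summit.HodgeConjecture.HodgeConjecture.Cruxes.HLiu418.K2LiuLatticeTraceDecaySumBound

open Summit.HodgeConjecture.HodgeConjecture.Cruxes.HLiu418.K2LiuLatticeExpDecaySumBound
  (exists_tsum_pow_mul_exp_neg_le mul_re_trace_le_re_trace_mul)
open Summit.HodgeConjecture.HodgeConjecture.Cruxes.HLiu418.K2LiuArchBlockHeightBound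

/-! ## §1 The general-size lattice bound (positive-definite part of a lattice in `S → M_p(ℂ)`) -/

section Lattice

variable {S p : Type*} [Fintype S] [Fintype p] [DecidableEq p]

omit [DecidableEq p] in
/-- an entry is bounded by the Pi sup norm on `S → (p → p → ℂ)`. [folklore] -/
theorem norm_apply_le_pi_norm (x : S → (p → p → ℂ)) (σ : S) (i j : p) : ‖x σ i j‖ ≤ ‖x‖ :=
  ((norm_le_pi_norm (x σ i) j).trans (norm_le_pi_norm (x σ) i)).trans (norm_le_pi_norm x σ)

omit [DecidableEq p] in
/-- if every entry of every component is `≤ T σ` (`T ≥ 0`) then `‖x‖ ≤ Σ_σ T σ`. [folklore] -/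
theorem pi_norm_le_sum {x : S → (p → p → ℂ)} {T : S → ℝ} (hT : ∀ σ, 0 ≤ T σ) (h : ∀ σ i j, ‖x σ i j‖ ≤ T σ) : ‖x‖ ≤ ∑ σ, T σ := by
  have hsum : 0 ≤ ∑ σ, T σ := Finset.sum_nonneg fun σ _ => hT σ
  refine (pi_norm_le_iff_of_nonneg hsum).2 fun σ => (pi_norm_le_iff_of_nonneg hsum).2 fun i => (pi_norm_le_iff_of_nonneg hsum).2 fun j => ?_
  exact (h σ i j).trans (Finset.single_le_sum (fun σ' _ => hT σ') (Finset.mem_univ σ))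

/-- **the pointwise comparison** (any block size): for `v : S → (p → p → ℂ)` with every `Matrix.of (v σ) ≻ 0`, `g_σ − ε•1 ⪰ 0` (`ε > 0`), `N ≥ 0` real and
`N · |S| ≤ Nn`: `∏_σ e^{−2π Re tr(v_σ g_σ)} (1 + Re tr v_σ)^N ≤ (1+|p|)^{N|S|} · (1+‖v‖)^{Nn} e^{−ε‖v‖}` (entries `≤ Re tr`, cone step).
[cite: MoeglinWaldspurger1995, II.1.5] [cite: Shimura1997, §A3] -/
theorem prod_trace_summand_le {N : ℝ} (hN : 0 ≤ N) {Nn : ℕ} (hNn : N * Fintype.card S ≤ Nn) {ε : ℝ} (hε : 0 < ε)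
    {g : S → Matrix p p ℂ} (hg : ∀ σ, (g σ - (ε : ℂ) • (1 : Matrix p p ℂ)).PosSemidef)
    {v : S → (p → p → ℂ)} (hv : ∀ σ, (Matrix.of (v σ)).PosDef) :
    0 ≤ ∏ σ, (Real.exp (-(2 * Real.pi * ((Matrix.of (v σ) * g σ).trace).re)) * (1 + ((Matrix.of (v σ)).trace).re) ^ N) ∧
    ∏ σ, (Real.exp (-(2 * Real.pi * ((Matrix.of (v σ) * g σ).trace).re)) * (1 + ((Matrix.of (v σ)).trace).re) ^ N) ≤
      ((1 + (Fintype.card p : ℝ)) ^ N) ^ Fintype.card S * ((1 + ‖v‖) ^ Nn * Real.exp (-(ε * ‖v‖))) := by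
  -- per-place data: `T σ := Re tr (Matrix.of (v σ)) ≥ 0`, entries `≤ T σ`, `T σ ≤ |p| ‖v‖`
  have hent : ∀ σ i j, ‖v σ i j‖ ≤ ((Matrix.of (v σ)).trace).re := fun σ i j => norm_apply_le_re_trace_of_posDef (hv σ) i j
  have hT0 : ∀ σ, 0 ≤ ((Matrix.of (v σ)).trace).re := by
    intro σ
    by_cases hp : Nonempty p
    · obtain ⟨i⟩ := hp
      exact (norm_nonneg _).trans (hent σ i i)
    · rw [re_trace_eq_sum]
      exact Finset.sum_nonneg fun i _ => absurd ⟨i⟩ hp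
  have hTle : ∀ σ, ((Matrix.of (v σ)).trace).re ≤ (Fintype.card p : ℝ) * ‖v‖ := fun σ => by
    rw [re_trace_eq_sum]
    calc ∑ k, ((Matrix.of (v σ)) k k).re ≤ ∑ _k : p, ‖v‖ := Finset.sum_le_sum fun k _ =>
          (Complex.re_le_norm _).trans (norm_apply_le_pi_norm v σ k k)
      _ = (Fintype.card p : ℝ) * ‖v‖ := by rw [Finset.sum_const, Finset.card_univ, nsmul_eq_mul]
  have hnorm : ‖v‖ ≤ ∑ σ, ((Matrix.of (v σ)).trace).re := pi_norm_le_sum hT0 hent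
  -- the factors
  have hexp : ∀ σ, Real.exp (-(2 * Real.pi * ((Matrix.of (v σ) * g σ).trace).re)) ≤ Real.exp (-(ε * ((Matrix.of (v σ)).trace).re)) := fun σ => by
    apply Real.exp_le_exp.2
    have hπ : 1 ≤ 2 * Real.pi := by linarith [Real.two_le_pi]
    have hcone := mul_re_trace_le_re_trace_mul (hv σ).posSemidef (hg σ)
    have h1 : ε * ((Matrix.of (v σ)).trace).re ≤ 2 * Real.pi * (ε * ((Matrix.of (v σ)).trace).re) :=
      le_mul_of_one_le_left (mul_nonneg hε.le (hT0 σ)) hπ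
    nlinarith
  have hpowN : ∀ σ, (1 + ((Matrix.of (v σ)).trace).re) ^ N ≤ (1 + (Fintype.card p : ℝ)) ^ N * (1 + ‖v‖) ^ N := fun σ => by
    rw [← Real.mul_rpow (by positivity) (by positivity)]
    refine Real.rpow_le_rpow (by linarith [hT0 σ]) ?_ hN
    nlinarith [hTle σ, norm_nonneg v, (Nat.cast_nonneg (Fintype.card p) : (0 : ℝ) ≤ Fintype.card p)]
  have hfac0 : ∀ σ, 0 ≤ Real.exp (-(2 * Real.pi * ((Matrix.of (v σ) * g σ).trace).re)) * (1 + ((Matrix.of (v σ)).trace).re) ^ N := fun σ =>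
    mul_nonneg (Real.exp_pos _).le (Real.rpow_nonneg (by linarith [hT0 σ]) _)
  have hprod : ∏ σ, (Real.exp (-(2 * Real.pi * ((Matrix.of (v σ) * g σ).trace).re)) * (1 + ((Matrix.of (v σ)).trace).re) ^ N) ≤
      ∏ σ, Real.exp (-(ε * ((Matrix.of (v σ)).trace).re)) * ((1 + (Fintype.card p : ℝ)) ^ N * (1 + ‖v‖) ^ N) :=
    Finset.prod_le_prod (fun σ _ => hfac0 σ) fun σ _ =>
      mul_le_mul (hexp σ) (hpowN σ) (Real.rpow_nonneg (by linarith [hT0 σ]) _) (Real.exp_pos _).le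
  have hprod' : ∏ σ, Real.exp (-(ε * ((Matrix.of (v σ)).trace).re)) * ((1 + (Fintype.card p : ℝ)) ^ N * (1 + ‖v‖) ^ N) =
      Real.exp (-(ε * ∑ σ, ((Matrix.of (v σ)).trace).re)) *
        (((1 + (Fintype.card p : ℝ)) ^ N) ^ Fintype.card S * ((1 + ‖v‖) ^ N) ^ Fintype.card S) := by
    rw [Finset.prod_mul_distrib, ← Real.exp_sum, Finset.prod_const, Finset.card_univ, mul_pow, Finset.mul_sum, ← Finset.sum_neg_distrib]
  have h1v : 1 ≤ 1 + ‖v‖ := by linarith [norm_nonneg v]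
  have hrpow : ((1 + ‖v‖) ^ N) ^ Fintype.card S ≤ (1 + ‖v‖) ^ Nn := by
    rw [← Real.rpow_natCast ((1 + ‖v‖) ^ N), ← Real.rpow_mul (by positivity), ← Real.rpow_natCast (1 + ‖v‖) Nn]
    exact Real.rpow_le_rpow_of_exponent_le h1v hNn
  have hexp' : Real.exp (-(ε * ∑ σ, ((Matrix.of (v σ)).trace).re)) ≤ Real.exp (-(ε * ‖v‖)) := by
    apply Real.exp_le_exp.2
    nlinarith [hnorm, hε.le]
  have hK0 : 0 ≤ ((1 + (Fintype.card p : ℝ)) ^ N) ^ Fintype.card S := by positivity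
  refine ⟨Finset.prod_nonneg fun σ _ => hfac0 σ, ?_⟩
  calc ∏ σ, (Real.exp (-(2 * Real.pi * ((Matrix.of (v σ) * g σ).trace).re)) * (1 + ((Matrix.of (v σ)).trace).re) ^ N)
      ≤ _ := hprod
    _ = _ := hprod'
    _ ≤ Real.exp (-(ε * ‖v‖)) * (((1 + (Fintype.card p : ℝ)) ^ N) ^ Fintype.card S * (1 + ‖v‖) ^ Nn) :=
        mul_le_mul hexp' (mul_le_mul_of_nonneg_left hrpow hK0) (by positivity) (Real.exp_pos _).le
    _ = ((1 + (Fintype.card p : ℝ)) ^ N) ^ Fintype.card S * ((1 + ‖v‖) ^ Nn * Real.exp (-(ε * ‖v‖))) := by ring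

variable (Λ : Submodule ℤ (S → (p → p → ℂ))) [DiscreteTopology Λ] [IsZLattice ℝ Λ]

/-- **THE GENERAL-SIZE LATTICE BOUND WITH PARAMETER**: `∃ C k, ∀ ε ∈ (0,1], ∀ g, (∀ σ, g_σ − ε•1 ⪰ 0) → Summable ∧
Σ'_{x ∈ Λ, x_σ ≻ 0} ∏_σ e^{−2π Re tr(x_σ g_σ)} (1 + Re tr x_σ)^N ≤ C / ε^k` (trace-spelled twin of ★ G7-A `exists_tsum_lattice_posDef_prod_le`).
[cite: Shimura1997, §A3] [cite: MoeglinWaldspurger1995, II.1.5] -/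
theorem exists_tsum_lattice_posDef_trace_le {N : ℝ} (hN : 0 ≤ N) :
    ∃ (C : ℝ) (k : ℕ), 0 ≤ C ∧ ∀ ε : ℝ, 0 < ε → ε ≤ 1 → ∀ g : S → Matrix p p ℂ,
      (∀ σ, (g σ - (ε : ℂ) • (1 : Matrix p p ℂ)).PosSemidef) →
      Summable (fun x : {x : Λ // ∀ σ, (Matrix.of ((x : S → (p → p → ℂ)) σ)).PosDef} =>
        ∏ σ, (Real.exp (-(2 * Real.pi * ((Matrix.of (((x : Λ) : S → (p → p → ℂ)) σ) * g σ).trace).re)) *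
          (1 + ((Matrix.of (((x : Λ) : S → (p → p → ℂ)) σ)).trace).re) ^ N)) ∧
      ∑' x : {x : Λ // ∀ σ, (Matrix.of ((x : S → (p → p → ℂ)) σ)).PosDef},
        ∏ σ, (Real.exp (-(2 * Real.pi * ((Matrix.of (((x : Λ) : S → (p → p → ℂ)) σ) * g σ).trace).re)) *
          (1 + ((Matrix.of (((x : Λ) : S → (p → p → ℂ)) σ)).trace).re) ^ N) ≤ C / ε ^ k := by
  obtain ⟨C₀, k, hC₀, hmain⟩ := exists_tsum_pow_mul_exp_neg_le Λ (⌈N⌉₊ * Fintype.card S)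
  have hNn : N * Fintype.card S ≤ ((⌈N⌉₊ * Fintype.card S : ℕ) : ℝ) := by
    rw [Nat.cast_mul]; exact mul_le_mul_of_nonneg_right (Nat.le_ceil N) (Nat.cast_nonneg _)
  set K : ℝ := ((1 + (Fintype.card p : ℝ)) ^ N) ^ Fintype.card S with hK
  have hK0 : 0 ≤ K := by positivity
  refine ⟨K * C₀, k, mul_nonneg hK0 hC₀, fun ε hε hε1 g hg => ?_⟩
  obtain ⟨hsum0, hle0⟩ := hmain ε hε hε1
  have hcmp := fun x : {x : Λ // ∀ σ, (Matrix.of ((x : S → (p → p → ℂ)) σ)).PosDef} => prod_trace_summand_le hN hNn hε hg x.2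
  have hFs : Summable fun x : {x : Λ // ∀ σ, (Matrix.of ((x : S → (p → p → ℂ)) σ)).PosDef} =>
      K * ((1 + ‖((x : Λ) : S → (p → p → ℂ))‖) ^ (⌈N⌉₊ * Fintype.card S) * Real.exp (-(ε * ‖((x : Λ) : S → (p → p → ℂ))‖))) :=
    (hsum0.mul_left _).subtype _
  have hfs := Summable.of_nonneg_of_le (fun x => (hcmp x).1) (fun x => (hcmp x).2) hFs
  refine ⟨hfs, ?_⟩
  have hF0 : ∀ x : Λ, 0 ≤ K * ((1 + ‖(x : S → (p → p → ℂ))‖) ^ (⌈N⌉₊ * Fintype.card S) * Real.exp (-(ε * ‖(x : S → (p → p → ℂ))‖))) :=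
    fun x => by positivity
  calc _ ≤ ∑' x : {x : Λ // ∀ σ, (Matrix.of ((x : S → (p → p → ℂ)) σ)).PosDef},
        K * ((1 + ‖((x : Λ) : S → (p → p → ℂ))‖) ^ (⌈N⌉₊ * Fintype.card S) * Real.exp (-(ε * ‖((x : Λ) : S → (p → p → ℂ))‖))) :=
        hfs.tsum_le_tsum (fun x => (hcmp x).2) hFs
    _ ≤ ∑' x : Λ, K * ((1 + ‖(x : S → (p → p → ℂ))‖) ^ (⌈N⌉₊ * Fintype.card S) * Real.exp (-(ε * ‖(x : S → (p → p → ℂ))‖))) :=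
        tsum_comp_le_tsum_of_inj (hsum0.mul_left _) hF0 Subtype.val_injective
    _ = K * ∑' x : Λ, (1 + ‖(x : S → (p → p → ℂ))‖) ^ (⌈N⌉₊ * Fintype.card S) * Real.exp (-(ε * ‖(x : S → (p → p → ℂ))‖)) := tsum_mul_left
    _ ≤ K * (C₀ / ε ^ k) := mul_le_mul_of_nonneg_left hle0 hK0
    _ = K * C₀ / ε ^ k := by ring

end Lattice

end Summit.HodgeConjecture.HodgeConjecture.Cruxes.HLiu418.K2LiuLatticeTraceDecaySumBound

end
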